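import Summits.AtomisticToContinuum.FouriersLaw.Theorems.BondHeatUncertaintyLinearResponseFTURSchemeLimit
import Literature.MathematicalPhysics.KineticTheory.LangevinChainEnergyIdentity

/-!
# Node recursion and measurability of the splitting schemes (K3 helper)

Helper file for stub `stub_antiDampedGirsanov` (K3) of line `lebesgue-flip-duality`, crux ★
`BondHeatUncertainty.LinearResponseFTUR` (stmt-AtomisticToContinuum-9122); sequel of `…SchemeLimit.lean`.

* `SchemeData.path_step` — one step of the scheme path: `z((k+1)h) = z(kh) + u_k + ∫_{kh}^{(k+1)h} Y₀(z)`;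
  `path_step_snd` — its momentum components; `impulse_snd_left` / `impulse_snd_right` — the bath
  components of the impulse (`ε c_b ΔB^b_k - σγh clamp_R(p_b(z_k))`, `N ≥ 2`);
* `dyadic_node_left` / `dyadic_node_right` — the node recursion of the dyadic schemes in the exact form
  consumed by `tendsto_ito_clamp` (`…LimitIdentification.lean`);
* `SchemeData.measurable_state` / `measurable_path` / `measurable_pathIntegral` — the states, the path at a
  fixed time and time integrals along the path are measurable functions of the increments
  (`ConfinedDrift.measurable_flow`, `measurable_impulse_comp`), for increments read off any measurable source.
-/

noncomputable section

namespace Summit.AtomisticToContinuum.FouriersLaw.Theorems.LinearResponseFTUR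

open MeasureTheory Filter Set Function Finset intervalIntegral Topology Metric
open scoped NNReal
open Literature.MathematicalPhysics.KineticTheory
open Literature.MathematicalPhysics.KineticTheory.HeatConduction
open Literature.Analysis.ODE

variable {N : ℕ}

/-- A momentum coordinate as a continuous linear functional. -/
def momCLM (b : Fin N) : PhaseSpace N →L[ℝ] ℝ :=
  (ContinuousLinearMap.proj b).comp (ContinuousLinearMap.snd ℝ (Fin N → ℝ) (Fin N → ℝ))

/-- `momCLM b z = p_b`. -/
@[simp] theorem momCLM_apply (b : Fin N) (z : PhaseSpace N) : momCLM b z = z.2 b := rfl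

/-- The momentum component of an interval integral of a continuous path. -/
theorem snd_intervalIntegral_apply {f : ℝ → PhaseSpace N} (hf : Continuous f) (a c : ℝ) (b : Fin N) :
    (∫ u in a..c, f u).2 b = ∫ u in a..c, (f u).2 b := by
  have h := (momCLM b).intervalIntegral_comp_comm (hf.intervalIntegrable (μ := volume) a c)
  simp only [momCLM_apply] at h
  exact h.symm

namespace SchemeData

/-! ### The bath components of the impulse -/

/-- The left-bath component of the impulse (`N ≥ 2`): `ε c_L x_L - σγh clamp_R(p_0(z))`. -/
theorem impulse_snd_left (D : SchemeData N) (hN : 2 ≤ N) (i0 : Fin N) (hi0 : i0.val = 0) (ε σ : ℝ)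
    (z : PhaseSpace N) (v : ℝ × ℝ) :
    (D.impulse ε σ z v).2 i0 = ε * (D.cL * v.1) - σ * D.γ * D.h * clampR D.R (z.2 i0) := by
  have hN0 : 0 < N := by omega
  have hne : i0.val ≠ N - 1 := by omega
  have e0 : (⟨0, hN0⟩ : Fin N) = i0 := Fin.ext hi0.symm
  simp only [impulse, noiseImpulse, frictionImpulse, bathVec, leftMom, dif_pos hN0, Prod.snd_sub,
    Prod.snd_add, Pi.sub_apply, Pi.add_apply, Prod.smul_snd, Pi.smul_apply, smul_eq_mul, if_pos hi0,
    if_neg hne, add_zero, e0]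

/-- The right-bath component of the impulse (`N ≥ 2`): `ε c_R x_R - σγh clamp_R(p_{N-1}(z))`. -/
theorem impulse_snd_right (D : SchemeData N) (hN : 2 ≤ N) (iN : Fin N) (hiN : iN.val = N - 1) (ε σ : ℝ)
    (z : PhaseSpace N) (v : ℝ × ℝ) :
    (D.impulse ε σ z v).2 iN = ε * (D.cR * v.2) - σ * D.γ * D.h * clampR D.R (z.2 iN) := by
  have hN0 : 0 < N := by omega
  have hne : iN.val ≠ 0 := by omega
  have eN : (⟨N - 1, by omega⟩ : Fin N) = iN := Fin.ext hiN.symm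
  simp only [impulse, noiseImpulse, frictionImpulse, bathVec, rightMom, dif_pos hN0, Prod.snd_sub,
    Prod.snd_add, Pi.sub_apply, Pi.add_apply, Prod.smul_snd, Pi.smul_apply, smul_eq_mul, if_neg hne,
    if_pos hiN, zero_add, eN]

/-! ### One step of the scheme path -/

variable {D : SchemeData N} {ε σ : ℝ} {M : ℕ} {y : PhaseSpace N} {x : ℕ → ℝ × ℝ}
variable (D₀ : ConfinedDrift D.Y₀) (hD₀ : D₀.noise = momentumSubspace N)
include D₀ hD₀

/-- **One step of the scheme path**: `z((k+1)h) = z(kh) + u_k + ∫_{kh}^{(k+1)h} Y₀(z(u)) du`. -/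
theorem path_step (hh : 0 < D.h) {k : ℕ} (hk : k < M) :
    D.path ε σ M y x (((k : ℝ) + 1) * D.h) =
      D.path ε σ M y x ((k : ℝ) * D.h) + D.impulse ε σ (D.state ε σ y x k) (x k) +
        ∫ u in ((k : ℝ) * D.h)..(((k : ℝ) + 1) * D.h), D.Y₀ (D.path ε σ M y x u) := by
  have heq := path_eq_integral (ε := ε) (σ := σ) (M := M) (y := y) (x := x) D₀ hD₀ (T := ((k : ℝ) + 1) * D.h)
  have hk0 : (0 : ℝ) ≤ (k : ℝ) * D.h := by positivity
  have h1 := heq ((k : ℝ) * D.h) ⟨hk0, by nlinarith⟩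
  have h2 := heq (((k : ℝ) + 1) * D.h) ⟨by positivity, le_rfl⟩
  have hF := D.forcing_grid_add_sub_eq_ramp ε σ M y x hh hk (r := D.h) ⟨hh.le, le_rfl⟩
  rw [ramp_of_le hh _ le_rfl, show (k : ℝ) * D.h + D.h = ((k : ℝ) + 1) * D.h by ring] at hF
  have hcont : Continuous fun u => D.Y₀ (D.path ε σ M y x u) :=
    D₀.contDiff_drift.continuous.comp (continuous_path D₀ hD₀)
  rw [h2, h1, ← integral_add_adjacent_intervals (hcont.intervalIntegrable 0 ((k : ℝ) * D.h))
    (hcont.intervalIntegrable ((k : ℝ) * D.h) (((k : ℝ) + 1) * D.h)), ← hF]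
  abel

/-- The momentum components of one step of the scheme path. -/
theorem path_step_snd (hh : 0 < D.h) {k : ℕ} (hk : k < M) (b : Fin N) :
    (D.path ε σ M y x (((k : ℝ) + 1) * D.h)).2 b =
      (D.path ε σ M y x ((k : ℝ) * D.h)).2 b + (D.impulse ε σ (D.state ε σ y x k) (x k)).2 b +
        ∫ u in ((k : ℝ) * D.h)..(((k : ℝ) + 1) * D.h), (D.Y₀ (D.path ε σ M y x u)).2 b := by
  have hcont : Continuous fun u => D.Y₀ (D.path ε σ M y x u) :=
    D₀.contDiff_drift.continuous.comp (continuous_path D₀ hD₀)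
  rw [path_step D₀ hD₀ hh hk, Prod.snd_add, Prod.snd_add, Pi.add_apply, Pi.add_apply,
    snd_intervalIntegral_apply hcont]

/-! ### Measurability in the increments -/

omit D₀ hD₀ in
/-- `bathVec N k (g ω)` is measurable for measurable `g`. -/
theorem measurable_bathVec_comp {Ω : Type*} [MeasurableSpace Ω] (k : ℕ) {g : Ω → ℝ} (hg : Measurable g) :
    Measurable fun ω => bathVec N k (g ω) := by
  unfold bathVec
  refine measurable_const.prodMk (measurable_pi_lambda _ fun i => ?_)
  split_ifs
  · exact hg
  · exact measurable_const

omit D₀ hD₀ in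
/-- The impulse is measurable along measurable (state, increments). -/
theorem measurable_impulse_comp (D : SchemeData N) (ε σ : ℝ) {Ω : Type*} [MeasurableSpace Ω]
    {Z : Ω → PhaseSpace N} (hZ : Measurable Z) {W : Ω → ℝ × ℝ} (hW : Measurable W) :
    Measurable fun ω => D.impulse ε σ (Z ω) (W ω) := by
  unfold impulse noiseImpulse frictionImpulse
  have hL : Measurable fun ω => leftMom N (Z ω) := by
    unfold leftMom; split_ifs
    · exact (measurable_pi_apply _).comp (measurable_snd.comp hZ)
    · exact measurable_const
  have hR : Measurable fun ω => rightMom N (Z ω) := by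
    unfold rightMom; split_ifs
    · exact (measurable_pi_apply _).comp (measurable_snd.comp hZ)
    · exact measurable_const
  have h1 : Measurable fun ω => bathVec N 0 (D.cL * (W ω).1) + bathVec N (N - 1) (D.cR * (W ω).2) :=
    (measurable_bathVec_comp 0 ((measurable_fst.comp hW).const_mul _)).add
      (measurable_bathVec_comp (N - 1) ((measurable_snd.comp hW).const_mul _))
  have h2 : Measurable fun ω => bathVec N 0 (clampR D.R (leftMom N (Z ω))) +
      bathVec N (N - 1) (clampR D.R (rightMom N (Z ω))) :=
    (measurable_bathVec_comp 0 ((continuous_clampR D.R).measurable.comp hL)).add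
      (measurable_bathVec_comp (N - 1) ((continuous_clampR D.R).measurable.comp hR))
  exact (h1.const_smul ε).sub (h2.const_smul (σ * D.γ * D.h))

variable {Ω : Type*} [MeasurableSpace Ω] {ξ : Ω → ℕ → ℝ × ℝ} (hξ : ∀ j, Measurable fun ω => ξ ω j)
include hξ

/-- The scheme states are measurable functions of the increments. -/
theorem measurable_state : ∀ k : ℕ, Measurable fun ω => D.state ε σ y (ξ ω) k := by
  intro k
  induction k with
  | zero => simp only [state_zero]; exact measurable_const
  | succ k ih =>
    simp only [state_succ]
    have himp : Measurable fun ω => D.impulse ε σ (D.state ε σ y (ξ ω) k) (ξ ω k) :=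
      D.measurable_impulse_comp ε σ ih (hξ k)
    refine D₀.measurable_flow ih (fun _ => continuous_ramp _ _)
      (fun _ s => by rw [hD₀]; exact ramp_mem_momentumSubspace _ (D.impulse_mem ε σ _ _) s)
      (fun s => ?_) D.h
    unfold ramp
    exact himp.const_smul (min (max s 0) D.h / D.h)

/-- The scheme forcing at a fixed time is a measurable function of the increments. -/
theorem measurable_forcing (s : ℝ) : Measurable fun ω => D.forcing ε σ M y (ξ ω) s := by
  unfold forcing
  refine Finset.measurable_sum _ fun j _ => ?_
  exact (D.measurable_impulse_comp ε σ (measurable_state D₀ hD₀ hξ j) (hξ j)).const_smul (stepFrac D.h j s / D.h)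

/-- The scheme path at a fixed time is a measurable function of the increments. -/
theorem measurable_path (s : ℝ) : Measurable fun ω => D.path ε σ M y (ξ ω) s := by
  unfold path
  exact D₀.measurable_flow measurable_const (fun ω => D.continuous_forcing ε σ M y (ξ ω))
    (fun _ u => forcing_mem_noise D₀ hD₀ u) (fun u => measurable_forcing D₀ hD₀ hξ u) s

/-- Time integrals of continuous functions along the scheme path are measurable in the increments. -/
theorem measurable_pathIntegral {f : PhaseSpace N → ℝ} (hf : Continuous f) (t : ℝ) :
    Measurable fun ω => ∫ s in (0 : ℝ)..t, f (D.path ε σ M y (ξ ω) s) :=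
  measurable_intervalIntegral_of_continuous_of_measurable
    (u := fun s ω => f (D.path ε σ M y (ξ ω) s))
    (fun _ => hf.comp (continuous_path D₀ hD₀)) (fun s => hf.measurable.comp (measurable_path D₀ hD₀ hξ s)) t

end SchemeData

/-! ### The node recursion of the dyadic schemes -/

section Dyadic

variable {Y₀ : PhaseSpace N → PhaseSpace N} (D₀ : ConfinedDrift Y₀) (hD₀ : D₀.noise = momentumSubspace N)
  {t : ℝ} (ht : 0 < t) (hN : 2 ≤ N) (γ R cL cR ε σ : ℝ) (y : PhaseSpace N) (xs : ℕ → ℕ → ℝ × ℝ)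
include D₀ hD₀ ht hN

/-- **Node recursion at the left bath** for the dyadic scheme paths `z_m` (mesh `h = t/2^m`):
`p_0(z_m((k+1)h)) = p_0(z_m(kh)) + ε c_L x^L_k - σγh clamp_R(p_0(z_m(kh))) + ∫_{kh}^{(k+1)h} Y₀(z_m)_0`. -/
theorem dyadic_node_left (i0 : Fin N) (hi0 : i0.val = 0) (m k : ℕ) (hk : k < 2 ^ m) :
    ((dyadic Y₀ γ R cL cR t m).path ε σ (2 ^ m) y (xs m) (((k : ℝ) + 1) * (t / 2 ^ m))).2 i0 =
      ((dyadic Y₀ γ R cL cR t m).path ε σ (2 ^ m) y (xs m) ((k : ℝ) * (t / 2 ^ m))).2 i0 +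
        ε * cL * (xs m k).1 -
        σ * γ * (t / 2 ^ m) *
          clampR R (((dyadic Y₀ γ R cL cR t m).path ε σ (2 ^ m) y (xs m) ((k : ℝ) * (t / 2 ^ m))).2 i0) +
        ∫ u in ((k : ℝ) * (t / 2 ^ m))..(((k : ℝ) + 1) * (t / 2 ^ m)),
          (Y₀ ((dyadic Y₀ γ R cL cR t m).path ε σ (2 ^ m) y (xs m) u)).2 i0 := by
  set D : SchemeData N := dyadic Y₀ γ R cL cR t m with hD
  have hh : 0 < D.h := by show 0 < t / 2 ^ m; positivity
  have hDh : D.h = t / 2 ^ m := rfl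
  have h := SchemeData.path_step_snd (D := D) (ε := ε) (σ := σ) (M := 2 ^ m) (y := y) (x := xs m) D₀ hD₀ hh hk i0
  rw [hDh] at h
  rw [h, SchemeData.impulse_snd_left D hN i0 hi0,
    ← SchemeData.path_grid (D := D) (ε := ε) (σ := σ) (y := y) (x := xs m) (M := 2 ^ m) D₀ hD₀ hh hk.le, hDh,
    show D.R = R from rfl, show D.cL = cL from rfl, show D.γ = γ from rfl, show D.Y₀ = Y₀ from rfl]
  ring

/-- **Node recursion at the right bath** for the dyadic scheme paths. -/
theorem dyadic_node_right (iN : Fin N) (hiN : iN.val = N - 1) (m k : ℕ) (hk : k < 2 ^ m) :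
    ((dyadic Y₀ γ R cL cR t m).path ε σ (2 ^ m) y (xs m) (((k : ℝ) + 1) * (t / 2 ^ m))).2 iN =
      ((dyadic Y₀ γ R cL cR t m).path ε σ (2 ^ m) y (xs m) ((k : ℝ) * (t / 2 ^ m))).2 iN +
        ε * cR * (xs m k).2 -
        σ * γ * (t / 2 ^ m) *
          clampR R (((dyadic Y₀ γ R cL cR t m).path ε σ (2 ^ m) y (xs m) ((k : ℝ) * (t / 2 ^ m))).2 iN) +
        ∫ u in ((k : ℝ) * (t / 2 ^ m))..(((k : ℝ) + 1) * (t / 2 ^ m)),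
          (Y₀ ((dyadic Y₀ γ R cL cR t m).path ε σ (2 ^ m) y (xs m) u)).2 iN := by
  set D : SchemeData N := dyadic Y₀ γ R cL cR t m with hD
  have hh : 0 < D.h := by show 0 < t / 2 ^ m; positivity
  have hDh : D.h = t / 2 ^ m := rfl
  have h := SchemeData.path_step_snd (D := D) (ε := ε) (σ := σ) (M := 2 ^ m) (y := y) (x := xs m) D₀ hD₀ hh hk iN
  rw [hDh] at h
  rw [h, SchemeData.impulse_snd_right D hN iN hiN,
    ← SchemeData.path_grid (D := D) (ε := ε) (σ := σ) (y := y) (x := xs m) (M := 2 ^ m) D₀ hD₀ hh hk.le, hDh,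
    show D.R = R from rfl, show D.cR = cR from rfl, show D.γ = γ from rfl, show D.Y₀ = Y₀ from rfl]
  ring

omit ht hN in
/-- The dyadic scheme paths are continuous. -/
theorem continuous_dyadic_path (m : ℕ) :
    Continuous ((dyadic Y₀ γ R cL cR t m).path ε σ (2 ^ m) y (xs m)) :=
  SchemeData.continuous_path (D := dyadic Y₀ γ R cL cR t m) D₀ hD₀

end Dyadic

/-- **One step of the scheme path** — `∀`-form registered as a sub-goal of the crux item. -/
theorem scheme_path_step :
    ∀ (N : ℕ) (D : SchemeData N) (D₀ : ConfinedDrift D.Y₀), D₀.noise = momentumSubspace N → 0 < D.h → ∀ (ε σ : ℝ) (M : ℕ) (y : PhaseSpace N) (x : ℕ → ℝ × ℝ) (k : ℕ), k < M → D.path ε σ M y x (((k : ℝ) + 1) * D.h) = D.path ε σ M y x ((k : ℝ) * D.h) + D.impulse ε σ (D.state ε σ y x k) (x k) + ∫ u in ((k : ℝ) * D.h)..(((k : ℝ) + 1) * D.h), D.Y₀ (D.path ε σ M y x u) :=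
  fun _ _ D₀ hD₀ hh _ _ _ _ _ _ hk => SchemeData.path_step D₀ hD₀ hh hk

end Summit.AtomisticToContinuum.FouriersLaw.Theorems.LinearResponseFTUR

end
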